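import Literature.Geometry.Lorentzian.GaussianBeamEnergy
import Literature.Analysis.Asymptotics.DirectionalNonStationaryPhase
import HarnessLib

/-!
# The oscillatory cross term of the energy of a real Gaussian beam is `O(1)`
(trunk G08 = T-LORENTZ, geometric optics; namespace `Literature.Geometry.Lorentzian.GaussianBeam`)

Sbierski, Anal. PDE 8 (2015), §4, third remark after the theorem (= arXiv:1311.2477v2, p. 17):
for the real beam `Re(a e^{iλφ})` "the computations become a bit longer", the energy density
containing, besides `½ e^{-2λ Im φ} densC(B, B̄)`, the oscillatory term
`½ Re(e^{2iλφ} densC(B, B))`; its leaf integrals are lower order by one integration by parts in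
a direction in which `Re φ` is non-stationary (`dφ|_γ = γ̇♭ ≠ 0`). This file proves the bound
`|∫ wdensO(τ, ·)| ≤ K_c` for `λ ≥ 1`, `0 ≤ τ ≤ T` (`BeamAmp.exists_cross_bound`), given a family
of directions `Z(τ)` with `Re ∂_{Z(τ)}(φ(τ, ·)) ≥ ½` on the beam, from the directional
non-stationary phase lemma `Literature.Analysis.Asymptotics.norm_integral_cexp_phase_mul_le_of_le`
(real phase `2 Re φ`, amplitude `e^{-2λ Im φ} densC(B, B)`), the flat bounds of
`GaussianBeamErrors` (the `λ`-costly derivative of the Gaussian weight carries `Im dφ`, which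
vanishes on `γ`) and the Gaussian leaf integrals; and it combines this with
`BeamAmp.energy_characterisation` (`BeamAmp.energy_characterisation'`).

## References

* J. Sbierski, *Characterisation of the energy of Gaussian beams on Lorentzian manifolds: with
  applications to black hole spacetimes*, Anal. PDE 8 (2015) 1379–1420, §4, third remark after the
  theorem; arXiv:1311.2477v2 §2.3 p. 17 (key `Sbierski2015`).
* L. Hörmander, *The analysis of linear partial differential operators I*, Springer 1983,
  Thm. 7.7.1 (key `HormanderALPDO1`).
-/

noncomputable section

open Set Filter Complex MeasureTheory
open scoped ContDiff Topology

namespace Literature.Geometry.Lorentzian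

namespace GaussianBeam

open KerrSchild Literature.Analysis.Asymptotics.GaussianBeam

namespace BeamAmp

variable {G : E4 → Fin 4 → Fin 4 → ℝ} {V : Set E4} {J : Set ℝ} {D : BeamData G V J} {T : ℝ}
  (A : BeamAmp D T)

/-! ### Flat bound for `g · Im ∂φ`, `g` supported in the beam -/

/-- `g · Im ∂_νφ` read on `ℝ × E3`, for a function `g` on the chart. [cite: Sbierski2015, §3 (3.12)] -/
def _root_.Literature.Geometry.Lorentzian.GaussianBeam.BeamData.gIm (D : BeamData G V J) (g : E4 → ℂ)
    (ν : Fin 4) (q : ℝ × E3) : ℂ :=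
  g (E4.ofTimeSpace q.1 q.2) * ((dC D.φ (E4.ofTimeSpace q.1 q.2) ν).im : ℂ)

/-- `g · Im ∂_νφ` is `C^∞` for `g ∈ C^∞` supported in the beam. [folklore] -/
theorem contDiff_gIm {g : E4 → ℂ} (hg : ContDiff ℝ ∞ g) (hgs : tsupport g ⊆ tsupport A.amp)
    (ν : Fin 4) : ContDiff ℝ ∞ (D.gIm g ν) := by
  have h : ContDiff ℝ ∞ fun x ↦ g x * ((dC D.φ x ν).im : ℂ) :=
    contDiff_mul_of_tsupport (isOpen_slab D.hJ) hg (hgs.trans A.tsupp_slab)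
      (Complex.ofRealCLM.contDiff.comp_contDiffOn
        (Complex.imCLM.contDiff.comp_contDiffOn (D.contDiffOn_dC_φ ν)))
  exact h.comp contDiff_ofTimeSpace_uncurry

/-- `g · Im ∂_νφ` has compact support for `g` compactly supported. [folklore] -/
theorem _root_.Literature.Geometry.Lorentzian.GaussianBeam.BeamData.hasCompactSupport_gIm
    (D : BeamData G V J) {g : E4 → ℂ} (hgc : HasCompactSupport g) (ν : Fin 4) :
    HasCompactSupport (D.gIm g ν) :=
  hasCompactSupport_comp_ofTimeSpace (f := fun x ↦ g x * ((dC D.φ x ν).im : ℂ)) hgc.mul_right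

/-- `g · Im ∂_νφ` vanishes along the centre (`Im dφ|_γ = 0`). [cite: Sbierski2015, §3 (3.12)] -/
theorem iteratedFDeriv_gIm_eq_zero {g : E4 → ℂ} (hgs : tsupport g ⊆ tsupport A.amp) (ν : Fin 4)
    (t : ℝ) {k : ℕ} (hk : k ≤ 0) :
    iteratedFDeriv ℝ k (fun y ↦ D.gIm g ν (t, y)) (A.ce t) = 0 := by
  obtain rfl : k = 0 := Nat.le_zero.1 hk
  ext m
  rw [iteratedFDeriv_zero_apply, zero_apply]
  by_cases ht : t ∈ A.timeHull
  · have htJ := A.timeHull_subset ht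
    rw [A.ce_eq ht]
    have hre : dC D.φ (E4.ofTimeSpace t (D.c t)) ν = (D.P t ν : ℂ) := by
      rw [BeamData.φ, dC_phase D.P D.M D.c D.hJ D.hP D.hM D.hc (by simpa using htJ) ν,
        dphase_curve D.P D.M D.c t (D.hPX t htJ)]
    simp [BeamData.gIm, hre]
  · have h0 : g (E4.ofTimeSpace t (A.ce t)) = 0 := by
      refine image_eq_zero_of_notMem_tsupport fun h ↦ ht ?_
      simpa using A.mem_timeHull_of_mem_tsupport (hgs h)
    simp [BeamData.gIm, h0]

/-- **Flat bound for `g · Im ∂φ`**, `g ∈ C^∞_c` supported in the beam: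
`‖g(x)‖ |Im ∂_νφ(x)| ≤ D_g ‖x⃗ − c(x⁰)‖` over the hull. [cite: Sbierski2015, §4 (proof of the theorem: "`dφ₂|_γ = 0`")] -/
theorem exists_gIm_bound {g : E4 → ℂ} (hg : ContDiff ℝ ∞ g) (hgc : HasCompactSupport g)
    (hgs : tsupport g ⊆ tsupport A.amp) : ∃ Dg : ℝ, 0 ≤ Dg ∧ ∀ t ∈ A.timeHull, ∀ y : E3, ∀ ν,
    ‖g (E4.ofTimeSpace t y)‖ * |(dC D.φ (E4.ofTimeSpace t y) ν).im| ≤ Dg * ‖y - D.c t‖ := by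
  have h : ∀ ν, ∃ Dν : ℝ, 0 ≤ Dν ∧ ∀ t y, ‖D.gIm g ν (t, y)‖ ≤ Dν * ‖y - A.ce t‖ ^ (0 + 1) := fun ν ↦
    exists_norm_le_norm_sub_pow A.ce A.contDiff_ce (D.gIm g ν) (A.contDiff_gIm hg hgs ν)
      (D.hasCompactSupport_gIm hgc ν) 0 fun t k hk ↦ A.iteratedFDeriv_gIm_eq_zero hgs ν t hk
  choose Dν hD0 hD using h
  refine ⟨∑ ν, Dν ν, Finset.sum_nonneg fun ν _ ↦ hD0 ν, fun t ht y ν ↦ ?_⟩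
  have h1 := hD ν t y
  rw [A.ce_eq ht, zero_add, pow_one] at h1
  have h2 : ‖D.gIm g ν (t, y)‖ = ‖g (E4.ofTimeSpace t y)‖ * |(dC D.φ (E4.ofTimeSpace t y) ν).im| := by
    rw [BeamData.gIm, norm_mul, Complex.norm_real, Real.norm_eq_abs]
  rw [h2] at h1
  exact h1.trans (mul_le_mul_of_nonneg_right
    (Finset.single_le_sum (f := Dν) (fun ν _ ↦ hD0 ν) (Finset.mem_univ ν)) (norm_nonneg _))

/-! ### The oscillatory density is a quadratic polynomial in `λ` -/

/-- **`densC(B, B) = P₀ + λ P₁ + λ² P₂`** with `P₀ = densC(∂a, ∂a)`,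
`P₁ = i a (densC(∂a, ∂φ) + densC(∂φ, ∂a))`, `P₂ = −a² densC(∂φ, ∂φ)`. [cite: Sbierski2015, §4 (third remark)] -/
theorem densO_expand (lam : ℝ) (x : E4) :
    A.densO lam x = densC G x (dC A.amp x) (dC A.amp x) +
      lam * (I * A.amp x * (densC G x (dC A.amp x) (dC D.φ x) + densC G x (dC D.φ x) (dC A.amp x))) +
      lam ^ 2 * (-(A.amp x) ^ 2 * densC G x (dC D.φ x) (dC D.φ x)) := by
  rw [densO, ← A.beamB_eq_Bc, beamB_eq, densC_add_left, densC_add_right, densC_add_right,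
    densC_smul_left, densC_smul_right, densC_smul_left, densC_smul_right]
  have hI : I * I = -1 := I_mul_I
  linear_combination ((lam : ℂ) ^ 2 * A.amp x ^ 2 * densC G x (dC D.φ x) (dC D.φ x)) * hI

/-- The coefficient `P₀ = densO 0`. [folklore] -/
def dd0 (x : E4) : ℂ := A.densO 0 x

/-- The coefficient `P₁ = (densO 1 − densO(−1))/2`. [folklore] -/
def dd1 (x : E4) : ℂ := 2⁻¹ * (A.densO 1 x - A.densO (-1) x)

/-- The coefficient `P₂ = (densO 1 + densO(−1))/2 − densO 0`. [folklore] -/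
def dd2 (x : E4) : ℂ := 2⁻¹ * (A.densO 1 x + A.densO (-1) x) - A.densO 0 x

/-- The coefficients by index. [folklore] -/
def dd (k : Fin 3) (x : E4) : ℂ := ![A.dd0 x, A.dd1 x, A.dd2 x] k

/-- **`densO λ = dd0 + λ dd1 + λ² dd2`** (interpolation of the quadratic polynomial at `0, ±1`).
[cite: Sbierski2015, §4 (third remark)] -/
theorem densO_eq_dd (lam : ℝ) (x : E4) :
    A.densO lam x = A.dd0 x + lam * A.dd1 x + lam ^ 2 * A.dd2 x := by
  have h := A.densO_expand lam x
  have h0 := A.densO_expand 0 x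
  have h1 := A.densO_expand 1 x
  have hm := A.densO_expand (-1) x
  simp only [dd0, dd1, dd2]
  rw [h, h0, h1, hm]
  push_cast
  ring

/-- The coefficients are `C^∞`. [folklore] -/
theorem contDiff_dd (k : Fin 3) : ContDiff ℝ ∞ (A.dd k) := by
  fin_cases k
  · exact A.contDiff_densO 0
  · exact contDiff_const.mul ((A.contDiff_densO 1).sub (A.contDiff_densO (-1)))
  · exact (contDiff_const.mul ((A.contDiff_densO 1).add (A.contDiff_densO (-1)))).sub
      (A.contDiff_densO 0)

/-- The coefficients vanish off `supp a`. [folklore] -/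
theorem dd_eq_zero (k : Fin 3) {x : E4} (hx : x ∉ tsupport A.amp) : A.dd k x = 0 := by
  fin_cases k <;> simp [dd, dd0, dd1, dd2, A.densO_eq_zero _ hx]

/-- `supp dd_k ⊆ supp a`. [folklore] -/
theorem tsupport_dd_subset (k : Fin 3) : tsupport (A.dd k) ⊆ tsupport A.amp :=
  closure_minimal (fun x hx ↦ by by_contra h; exact hx (A.dd_eq_zero k h)) (isClosed_tsupport _)

/-- The coefficients have compact support. [folklore] -/
theorem hasCompactSupport_dd (k : Fin 3) : HasCompactSupport (A.dd k) :=
  IsCompact.of_isClosed_subset A.compact (isClosed_tsupport _) (A.tsupport_dd_subset k)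

/-- `densO λ = ∑_k λ^k dd_k`, by index. [folklore] -/
theorem densO_eq_sum (lam : ℝ) (x : E4) :
    A.densO lam x = ∑ k : Fin 3, (lam : ℂ) ^ (k : ℕ) * A.dd k x := by
  rw [A.densO_eq_dd lam x, Fin.sum_univ_three]
  simp [dd]

/-- **Uniform bounds for the coefficients**: `‖dd_k‖ ≤ N`, `‖∂ dd_k‖ ≤ M` (operator norm) and
the flat bound `‖dd_k(x)‖ |Im ∂_νφ(x)| ≤ D_d ‖x⃗ − c(x⁰)‖` over the hull. [folklore] -/
theorem exists_dd_bounds : ∃ N M Dd : ℝ, 0 ≤ N ∧ 0 ≤ M ∧ 0 ≤ Dd ∧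
    (∀ k x, ‖A.dd k x‖ ≤ N) ∧ (∀ k x, ‖fderiv ℝ (A.dd k) x‖ ≤ M) ∧
    (∀ k, ∀ t ∈ A.timeHull, ∀ y : E3, ∀ ν,
      ‖A.dd k (E4.ofTimeSpace t y)‖ * |(dC D.φ (E4.ofTimeSpace t y) ν).im| ≤ Dd * ‖y - D.c t‖) := by
  have hN : ∀ k, ∃ C : ℝ, ∀ x, ‖A.dd k x‖ ≤ C := fun k ↦
    (A.contDiff_dd k).continuous.bounded_above_of_compact_support (A.hasCompactSupport_dd k)
  have hM : ∀ k, ∃ C : ℝ, ∀ x, ‖fderiv ℝ (A.dd k) x‖ ≤ C := fun k ↦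
    ((A.contDiff_dd k).continuous_fderiv (by simp)).bounded_above_of_compact_support
      ((A.hasCompactSupport_dd k).fderiv ℝ)
  have hD : ∀ k, ∃ Dg : ℝ, 0 ≤ Dg ∧ ∀ t ∈ A.timeHull, ∀ y : E3, ∀ ν,
      ‖A.dd k (E4.ofTimeSpace t y)‖ * |(dC D.φ (E4.ofTimeSpace t y) ν).im| ≤ Dg * ‖y - D.c t‖ := fun k ↦
    A.exists_gIm_bound (A.contDiff_dd k) (A.hasCompactSupport_dd k) (A.tsupport_dd_subset k)
  choose N hN using hN
  choose M hM using hM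
  choose Dg hDg0 hDg using hD
  refine ⟨∑ k, max (N k) 0, ∑ k, max (M k) 0, ∑ k, Dg k,
    Finset.sum_nonneg fun _ _ ↦ le_max_right _ _, Finset.sum_nonneg fun _ _ ↦ le_max_right _ _,
    Finset.sum_nonneg fun k _ ↦ hDg0 k, fun k x ↦ ?_, fun k x ↦ ?_, fun k t ht y ν ↦ ?_⟩
  · exact ((hN k x).trans (le_max_left _ _)).trans
      (Finset.single_le_sum (f := fun k ↦ max (N k) 0) (fun _ _ ↦ le_max_right _ _) (Finset.mem_univ k))
  · exact ((hM k x).trans (le_max_left _ _)).trans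
      (Finset.single_le_sum (f := fun k ↦ max (M k) 0) (fun _ _ ↦ le_max_right _ _) (Finset.mem_univ k))
  · exact (hDg k t ht y ν).trans (mul_le_mul_of_nonneg_right
      (Finset.single_le_sum (f := Dg) (fun k _ ↦ hDg0 k) (Finset.mem_univ k)) (norm_nonneg _))

end BeamAmp

/-! ### Slices: linear algebra of the slice maps -/

/-- The slice map `y ↦ (t, y)` has differential `spaceEmbed`. [folklore] -/
theorem hasFDerivAt_slice (t : ℝ) (y : E3) :
    HasFDerivAt (fun y : E3 ↦ E4.ofTimeSpace t y) E4.spaceEmbed y := by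
  have : (fun y : E3 ↦ E4.ofTimeSpace t y) = fun y ↦ t • E4.basisVector 0 + E4.spaceEmbed y :=
    funext (E4.ofTimeSpace_eq_smul_add' t)
  rw [this]
  exact E4.spaceEmbed.hasFDerivAt.const_add _

/-- Components of a vector of `E4` are bounded by its norm. [folklore] -/
theorem abs_apply_le_norm_E4 (w : E4) (ν : Fin 4) : |w ν| ≤ ‖w‖ := by
  rw [← Real.norm_eq_abs]
  exact PiLp.norm_apply_le w ν

/-- A differential expanded in the coordinate basis: `du(x)(w) = ∑_ν w_ν ∂_νu(x)`. [folklore] -/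
theorem fderiv_apply_eq_sum_dC (u : E4 → ℂ) (x w : E4) :
    fderiv ℝ u x w = ∑ ν, (w ν : ℂ) * dC u x ν := by
  conv_lhs => rw [eq_sum_smul_basisVector w]
  simp only [map_sum, map_smul, dC, Complex.real_smul]

/-- `‖g‖ |Im du(x)(w)| ≤ ∑_ν |w_ν| (‖g‖ |Im ∂_νu(x)|)`. [folklore] -/
theorem norm_mul_abs_im_fderiv_le (u : E4 → ℂ) (x w : E4) (g : ℂ) :
    ‖g‖ * |(fderiv ℝ u x w).im| ≤ ∑ ν, |w ν| * (‖g‖ * |(dC u x ν).im|) := by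
  rw [fderiv_apply_eq_sum_dC u x w, Complex.im_sum]
  have him : ∀ ν, ((w ν : ℂ) * dC u x ν).im = w ν * (dC u x ν).im := fun ν ↦ by simp
  calc ‖g‖ * |∑ ν, ((w ν : ℂ) * dC u x ν).im| ≤ ‖g‖ * ∑ ν, |((w ν : ℂ) * dC u x ν).im| :=
        mul_le_mul_of_nonneg_left (Finset.abs_sum_le_sum_abs _ _) (norm_nonneg _)
    _ = ∑ ν, |w ν| * (‖g‖ * |(dC u x ν).im|) := by
        rw [Finset.mul_sum]
        exact Finset.sum_congr rfl fun ν _ ↦ by rw [him ν, abs_mul]; ring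

/-! ### Slices of the phase: the real phase `ψ = 2 Re φ(τ, ·)` and its derivatives -/

namespace BeamData

variable {G : E4 → Fin 4 → Fin 4 → ℝ} {V : Set E4} {J : Set ℝ} (D : BeamData G V J)

/-- **The real phase of the slice**: `ψ_τ(y) = 2 Re φ(τ, y)`. [cite: Sbierski2015, §4 (third remark)] -/
def ψs (τ : ℝ) (y : E3) : ℝ := 2 * (D.φ (E4.ofTimeSpace τ y)).re

variable {τ : ℝ} (hτ : τ ∈ J)
include hτ

/-- The slice lies in the slab. [folklore] -/
theorem slice_mem (y : E3) : E4.ofTimeSpace τ y ∈ {x : E4 | x 0 ∈ J} := by simpa using hτ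

/-- The phase is differentiable at the points of a slice in the slab. [folklore] -/
theorem differentiableAt_φ_slice (y : E3) : DifferentiableAt ℝ D.φ (E4.ofTimeSpace τ y) :=
  (D.contDiffOn_φ.contDiffAt ((isOpen_slab D.hJ).mem_nhds (slice_mem hτ y))).differentiableAt
    (by simp)

/-- `dφ` is differentiable at the points of a slice in the slab. [folklore] -/
theorem differentiableAt_fderiv_φ_slice (y : E3) :
    DifferentiableAt ℝ (fderiv ℝ D.φ) (E4.ofTimeSpace τ y) :=
  ((D.contDiffOn_φ.fderiv_of_isOpen (isOpen_slab D.hJ) (m := ∞) (by simp)).contDiffAt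
    ((isOpen_slab D.hJ).mem_nhds (slice_mem hτ y))).differentiableAt (by simp)

/-- The slice of the phase is `C^∞`. [folklore] -/
theorem contDiff_φ_slice : ContDiff ℝ ∞ fun y : E3 ↦ D.φ (E4.ofTimeSpace τ y) :=
  D.contDiffOn_φ.comp_contDiff (E4.contDiff_ofTimeSpace τ) (slice_mem hτ)

/-- `ψ_τ` is `C^∞`. [folklore] -/
theorem contDiff_ψs : ContDiff ℝ ∞ (D.ψs τ) :=
  contDiff_const.mul (Complex.reCLM.contDiff.comp (D.contDiff_φ_slice hτ))

/-- The derivative of the slice of the phase: `∂_v(φ(τ,·))(y) = dφ(τ,y)(0, v)`. [folklore] -/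
theorem fderiv_φ_slice (y v : E3) :
    fderiv ℝ (fun y : E3 ↦ D.φ (E4.ofTimeSpace τ y)) y v =
      fderiv ℝ D.φ (E4.ofTimeSpace τ y) (E4.spaceEmbed v) := by
  have h : HasFDerivAt (fun y : E3 ↦ D.φ (E4.ofTimeSpace τ y))
      ((fderiv ℝ D.φ (E4.ofTimeSpace τ y)).comp E4.spaceEmbed) y :=
    (D.differentiableAt_φ_slice hτ y).hasFDerivAt.comp y (hasFDerivAt_slice τ y)
  rw [h.fderiv]
  rfl

/-- **`∂_vψ_τ(y) = 2 Re dφ(τ,y)(0,v)`.** [folklore] -/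
theorem fderiv_ψs (y v : E3) :
    fderiv ℝ (D.ψs τ) y v = 2 * (fderiv ℝ D.φ (E4.ofTimeSpace τ y) (E4.spaceEmbed v)).re := by
  have h1 : HasFDerivAt (fun y : E3 ↦ D.φ (E4.ofTimeSpace τ y))
      ((fderiv ℝ D.φ (E4.ofTimeSpace τ y)).comp E4.spaceEmbed) y :=
    (D.differentiableAt_φ_slice hτ y).hasFDerivAt.comp y (hasFDerivAt_slice τ y)
  have h2 := (Complex.reCLM.hasFDerivAt.comp y h1).const_mul (2 : ℝ)
  have h3 : HasFDerivAt (D.ψs τ) ((2 : ℝ) • (Complex.reCLM.comp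
      ((fderiv ℝ D.φ (E4.ofTimeSpace τ y)).comp E4.spaceEmbed))) y := h2
  rw [h3.fderiv]
  simp

/-- **`∂_v∂_vψ_τ(y) = 2 Re d²φ(τ,y)((0,v),(0,v))`.** [folklore] -/
theorem fderiv_fderiv_ψs (y v : E3) :
    fderiv ℝ (fun z ↦ fderiv ℝ (D.ψs τ) z v) y v =
      2 * ((fderiv ℝ (fderiv ℝ D.φ) (E4.ofTimeSpace τ y) (E4.spaceEmbed v)) (E4.spaceEmbed v)).re := by
  have hfun : (fun z ↦ fderiv ℝ (D.ψs τ) z v) =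
      fun z ↦ 2 * ((fderiv ℝ D.φ (E4.ofTimeSpace τ z)) (E4.spaceEmbed v)).re :=
    funext fun z ↦ D.fderiv_ψs hτ z v
  rw [hfun]
  have hc : HasFDerivAt (fun z : E3 ↦ fderiv ℝ D.φ (E4.ofTimeSpace τ z))
      ((fderiv ℝ (fderiv ℝ D.φ) (E4.ofTimeSpace τ y)).comp E4.spaceEmbed) y :=
    (D.differentiableAt_fderiv_φ_slice hτ y).hasFDerivAt.comp y (hasFDerivAt_slice τ y)
  have happ := hc.clm_apply (hasFDerivAt_const (E4.spaceEmbed v) y)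
  have h2 := (Complex.reCLM.hasFDerivAt.comp y happ).const_mul (2 : ℝ)
  have h3 : HasFDerivAt (fun z ↦ 2 * ((fderiv ℝ D.φ (E4.ofTimeSpace τ z)) (E4.spaceEmbed v)).re)
      ((2 : ℝ) • (Complex.reCLM.comp (((fderiv ℝ D.φ (E4.ofTimeSpace τ y)).comp
        (0 : E3 →L[ℝ] E4)) + ((fderiv ℝ (fderiv ℝ D.φ) (E4.ofTimeSpace τ y)).comp
          E4.spaceEmbed).flip (E4.spaceEmbed v)))) y := h2
  rw [h3.fderiv]
  simp

end BeamData

/-! ### The weighted amplitude `F_λ = e^{-2λ Im φ} densO_λ` -/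

namespace BeamAmp

variable {G : E4 → Fin 4 → Fin 4 → ℝ} {V : Set E4} {J : Set ℝ} {D : BeamData G V J} {T : ℝ}
  (A : BeamAmp D T)

/-- **The weighted amplitude on the chart**: `F_λ = e^{-2λ Im φ} densO_λ`, `C^∞` with compact
support in `supp a`. [cite: Sbierski2015, §4 (third remark)] -/
def Fw (lam : ℝ) (x : E4) : ℂ := (D.gw lam x : ℂ) * A.densO lam x

/-- `F_λ` is `C^∞`. [folklore] -/
theorem contDiff_Fw (lam : ℝ) : ContDiff ℝ ∞ (A.Fw lam) :=
  contDiff_mul_of_tsupport' (isOpen_slab D.hJ) (A.contDiff_densO lam)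
    ((A.tsupport_densO_subset lam).trans A.tsupp_slab)
    (Complex.ofRealCLM.contDiff.comp_contDiffOn (D.contDiffOn_gw lam))

/-- `F_λ` vanishes off `supp a`. [folklore] -/
theorem Fw_eq_zero (lam : ℝ) {x : E4} (hx : x ∉ tsupport A.amp) : A.Fw lam x = 0 := by
  simp [Fw, A.densO_eq_zero lam hx]

/-- `F_λ` has compact support. [folklore] -/
theorem hasCompactSupport_Fw (lam : ℝ) : HasCompactSupport (A.Fw lam) :=
  IsCompact.of_isClosed_subset A.compact (isClosed_tsupport _)
    (closure_minimal (fun x hx ↦ by by_contra h; exact hx (A.Fw_eq_zero lam h)) (isClosed_tsupport _))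

/-- **The oscillatory integrand factorises**: `e^{2iλφ} densO = e^{iλψ} F_λ` on the slice.
[cite: Sbierski2015, §4 (third remark)] -/
theorem cexp_mul_densO_eq (lam τ : ℝ) (y : E3) :
    cexp (2 * I * lam * D.φ (E4.ofTimeSpace τ y)) * A.densO lam (E4.ofTimeSpace τ y) =
      cexp (I * lam * (D.ψs τ y)) * A.Fw lam (E4.ofTimeSpace τ y) := by
  set p := D.φ (E4.ofTimeSpace τ y) with hp
  have hsplit : 2 * I * lam * p = I * lam * ((2 * p.re : ℝ) : ℂ) + ((-2 * lam * p.im : ℝ) : ℂ) := by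
    conv_lhs => rw [← re_add_im p]
    push_cast
    ring_nf
    rw [I_sq]
    ring
  have hψ : D.ψs τ y = 2 * p.re := rfl
  rw [hsplit, Complex.exp_add, Fw, BeamData.gw, hψ, Complex.ofReal_exp]
  push_cast
  ring

/-- **The derivative of `F_λ` at a point of the beam**:
`dF_λ(x)(w) = e^{-2λφ₂} (d densO_λ(x)(w) − 2λ Im(dφ(x)(w)) densO_λ(x))`. [folklore] -/
theorem fderiv_Fw_apply (lam : ℝ) {x : E4} (hx : x ∈ tsupport A.amp) (w : E4) :
    fderiv ℝ (A.Fw lam) x w = (D.gw lam x : ℂ) * (fderiv ℝ (A.densO lam) x w -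
      2 * lam * ((fderiv ℝ D.φ x w).im : ℂ) * A.densO lam x) := by
  have hxJ : x 0 ∈ J := A.tsupp_slab hx
  have hφd : DifferentiableAt ℝ D.φ x :=
    (D.contDiffOn_φ.contDiffAt ((isOpen_slab D.hJ).mem_nhds hxJ)).differentiableAt (by simp)
  have hgw : HasFDerivAt (fun y ↦ (D.gw lam y : ℂ)) (Complex.ofRealCLM.comp
      (D.gw lam x • ((-2 * lam) • (Complex.imCLM.comp (fderiv ℝ D.φ x))))) x := by
    have h1 : HasFDerivAt (fun y ↦ (D.φ y).im) (Complex.imCLM.comp (fderiv ℝ D.φ x)) x :=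
      Complex.imCLM.hasFDerivAt.comp x hφd.hasFDerivAt
    have h2 : HasFDerivAt (D.gw lam) (D.gw lam x • ((-2 * lam) • (Complex.imCLM.comp (fderiv ℝ D.φ x)))) x :=
      (h1.const_mul (-2 * lam)).exp
    exact Complex.ofRealCLM.hasFDerivAt.comp x h2
  have hO : HasFDerivAt (A.densO lam) (fderiv ℝ (A.densO lam) x) x :=
    ((A.contDiff_densO lam).differentiable (by simp) x).hasFDerivAt
  have h := hgw.mul hO
  have h' : HasFDerivAt (A.Fw lam) _ x := h
  rw [h'.fderiv]
  simp [smul_eq_mul]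
  ring

/-- **The derivative of `densO_λ` is that of the coefficients**:
`d densO_λ(x) = ∑_k λ^k d dd_k(x)`. [folklore] -/
theorem fderiv_densO_apply (lam : ℝ) (x w : E4) :
    fderiv ℝ (A.densO lam) x w = ∑ k : Fin 3, (lam : ℂ) ^ (k : ℕ) * fderiv ℝ (A.dd k) x w := by
  have hfun : A.densO lam = fun x ↦ ∑ k : Fin 3, (lam : ℂ) ^ (k : ℕ) * A.dd k x :=
    funext (A.densO_eq_sum lam)
  have h : HasFDerivAt (fun x ↦ ∑ k : Fin 3, (lam : ℂ) ^ (k : ℕ) * A.dd k x)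
      (∑ k : Fin 3, (lam : ℂ) ^ (k : ℕ) • fderiv ℝ (A.dd k) x) x :=
    HasFDerivAt.fun_sum fun k _ ↦
      (((A.contDiff_dd k).differentiable (by simp) x).hasFDerivAt).const_mul _
  rw [hfun, h.fderiv]
  simp [smul_eq_mul]

end BeamAmp

/-! ### Pointwise bounds on the beam -/

namespace BeamAmp

variable {G : E4 → Fin 4 → Fin 4 → ℝ} {V : Set E4} {J : Set ℝ} {D : BeamData G V J} {T : ℝ}
  (A : BeamAmp D T)

/-- `λ^k ≤ λ²` for `k < 3`, `λ ≥ 1`. [folklore] -/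
theorem pow_fin3_le {lam : ℝ} (hlam : 1 ≤ lam) (k : Fin 3) : lam ^ (k : ℕ) ≤ lam ^ 2 :=
  pow_le_pow_right₀ hlam (Nat.lt_succ_iff.1 k.is_lt)

/-- **`‖d densO_λ(x)(w)‖ ≤ 3λ² M ‖w‖`.** [folklore] -/
theorem norm_fderiv_densO_le {M : ℝ} (hM : ∀ k x, ‖fderiv ℝ (A.dd k) x‖ ≤ M) {lam : ℝ}
    (hlam : 1 ≤ lam) (x w : E4) : ‖fderiv ℝ (A.densO lam) x w‖ ≤ 3 * lam ^ 2 * M * ‖w‖ := by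
  have hM0 : 0 ≤ M := (norm_nonneg _).trans (hM 0 x)
  rw [A.fderiv_densO_apply lam x w]
  refine (norm_sum_le _ _).trans ?_
  have hterm : ∀ k : Fin 3, ‖(lam : ℂ) ^ (k : ℕ) * fderiv ℝ (A.dd k) x w‖ ≤ lam ^ 2 * M * ‖w‖ := by
    intro k
    rw [norm_mul, norm_pow, Complex.norm_real, Real.norm_eq_abs, abs_of_nonneg (by linarith)]
    have h1 : ‖fderiv ℝ (A.dd k) x w‖ ≤ M * ‖w‖ :=
      (ContinuousLinearMap.le_opNorm _ _).trans (mul_le_mul_of_nonneg_right (hM k x) (norm_nonneg _))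
    calc lam ^ (k : ℕ) * ‖fderiv ℝ (A.dd k) x w‖ ≤ lam ^ 2 * (M * ‖w‖) :=
          mul_le_mul (pow_fin3_le hlam k) h1 (norm_nonneg _) (by positivity)
      _ = lam ^ 2 * M * ‖w‖ := by ring
  calc ∑ k : Fin 3, ‖(lam : ℂ) ^ (k : ℕ) * fderiv ℝ (A.dd k) x w‖ ≤ ∑ _k : Fin 3, lam ^ 2 * M * ‖w‖ :=
        Finset.sum_le_sum fun k _ ↦ hterm k
    _ = 3 * lam ^ 2 * M * ‖w‖ := by simp; ring

/-- **`‖densO_λ(x)‖ ≤ 3λ² N`.** [folklore] -/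
theorem norm_densO_le {N : ℝ} (hN : ∀ k x, ‖A.dd k x‖ ≤ N) {lam : ℝ} (hlam : 1 ≤ lam) (x : E4) :
    ‖A.densO lam x‖ ≤ 3 * lam ^ 2 * N := by
  have hN0 : 0 ≤ N := (norm_nonneg _).trans (hN 0 x)
  rw [A.densO_eq_sum lam x]
  refine (norm_sum_le _ _).trans ?_
  have hterm : ∀ k : Fin 3, ‖(lam : ℂ) ^ (k : ℕ) * A.dd k x‖ ≤ lam ^ 2 * N := by
    intro k
    rw [norm_mul, norm_pow, Complex.norm_real, Real.norm_eq_abs, abs_of_nonneg (by linarith)]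
    exact mul_le_mul (pow_fin3_le hlam k) (hN k x) (norm_nonneg _) (by positivity)
  calc ∑ k : Fin 3, ‖(lam : ℂ) ^ (k : ℕ) * A.dd k x‖ ≤ ∑ _k : Fin 3, lam ^ 2 * N :=
        Finset.sum_le_sum fun k _ ↦ hterm k
    _ = 3 * lam ^ 2 * N := by simp; ring

/-- **`‖densO_λ(x)‖ |Im dφ(x)(w)| ≤ 12 λ² ‖w‖ D_d ‖x⃗ − c(x⁰)‖`** over the hull (the flat bound:
`Im dφ` vanishes on the geodesic). [cite: Sbierski2015, §4 (proof of the theorem: "`dφ₂|_γ = 0`")] -/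
theorem norm_densO_mul_abs_im_le {Dd : ℝ}
    (hDd : ∀ k, ∀ t ∈ A.timeHull, ∀ y : E3, ∀ ν,
      ‖A.dd k (E4.ofTimeSpace t y)‖ * |(dC D.φ (E4.ofTimeSpace t y) ν).im| ≤ Dd * ‖y - D.c t‖)
    {lam : ℝ} (hlam : 1 ≤ lam) {t : ℝ} (ht : t ∈ A.timeHull) (y : E3) (w : E4) :
    ‖A.densO lam (E4.ofTimeSpace t y)‖ * |(fderiv ℝ D.φ (E4.ofTimeSpace t y) w).im| ≤
      12 * lam ^ 2 * ‖w‖ * Dd * ‖y - D.c t‖ := by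
  set x := E4.ofTimeSpace t y with hx
  -- `‖densO‖ |Im| ≤ ∑_k λ^k ‖dd_k‖ |Im|`
  have h1 : ‖A.densO lam x‖ * |(fderiv ℝ D.φ x w).im| ≤
      ∑ k : Fin 3, lam ^ (k : ℕ) * (‖A.dd k x‖ * |(fderiv ℝ D.φ x w).im|) := by
    rw [A.densO_eq_sum lam x]
    calc ‖∑ k : Fin 3, (lam : ℂ) ^ (k : ℕ) * A.dd k x‖ * |(fderiv ℝ D.φ x w).im|
        ≤ (∑ k : Fin 3, ‖(lam : ℂ) ^ (k : ℕ) * A.dd k x‖) * |(fderiv ℝ D.φ x w).im| :=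
          mul_le_mul_of_nonneg_right (norm_sum_le _ _) (abs_nonneg _)
      _ = ∑ k : Fin 3, lam ^ (k : ℕ) * (‖A.dd k x‖ * |(fderiv ℝ D.φ x w).im|) := by
          rw [Finset.sum_mul]
          refine Finset.sum_congr rfl fun k _ ↦ ?_
          rw [norm_mul, norm_pow, Complex.norm_real, Real.norm_eq_abs, abs_of_nonneg (by linarith)]
          ring
  -- each `‖dd_k‖ |Im dφ(w)| ≤ ∑_ν |w_ν| D_d d ≤ 4 ‖w‖ D_d d`
  have h2 : ∀ k : Fin 3, ‖A.dd k x‖ * |(fderiv ℝ D.φ x w).im| ≤ 4 * ‖w‖ * Dd * ‖y - D.c t‖ := by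
    intro k
    refine (norm_mul_abs_im_fderiv_le D.φ x w (A.dd k x)).trans ?_
    calc ∑ ν, |w ν| * (‖A.dd k x‖ * |(dC D.φ x ν).im|) ≤ ∑ _ν : Fin 4, ‖w‖ * (Dd * ‖y - D.c t‖) :=
          Finset.sum_le_sum fun ν _ ↦ mul_le_mul (abs_apply_le_norm_E4 w ν) (hDd k t ht y ν)
            (by positivity) (norm_nonneg _)
      _ = 4 * ‖w‖ * Dd * ‖y - D.c t‖ := by simp; ring
  calc ‖A.densO lam x‖ * |(fderiv ℝ D.φ x w).im|
      ≤ ∑ k : Fin 3, lam ^ (k : ℕ) * (‖A.dd k x‖ * |(fderiv ℝ D.φ x w).im|) := h1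
    _ ≤ ∑ _k : Fin 3, lam ^ 2 * (4 * ‖w‖ * Dd * ‖y - D.c t‖) :=
        Finset.sum_le_sum fun k _ ↦ mul_le_mul (pow_fin3_le hlam k) (h2 k) (by positivity) (by positivity)
    _ = 12 * lam ^ 2 * ‖w‖ * Dd * ‖y - D.c t‖ := by simp; ring

/-- **Pointwise bound for the derivative of the weighted amplitude along the beam**:
`‖dF_λ(t,y)(w)‖ ≤ e^{-2λc₀‖y−c(t)‖²} (3λ² M ‖w‖ + 24 λ³ ‖w‖ D_d ‖y − c(t)‖)` over the hull.
[cite: Sbierski2015, §4 (third remark)] -/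
theorem norm_fderiv_Fw_le {M Dd c₀ : ℝ} (hM : ∀ k x, ‖fderiv ℝ (A.dd k) x‖ ≤ M)
    (hDd : ∀ k, ∀ t ∈ A.timeHull, ∀ y : E3, ∀ ν,
      ‖A.dd k (E4.ofTimeSpace t y)‖ * |(dC D.φ (E4.ofTimeSpace t y) ν).im| ≤ Dd * ‖y - D.c t‖)
    (hIm : ∀ x : E4, x 0 ∈ A.timeHull → c₀ * ‖E4.spatial x - D.c (x 0)‖ ^ 2 ≤ (D.φ x).im)
    {lam : ℝ} (hlam : 1 ≤ lam) {t : ℝ} (ht : t ∈ A.timeHull) (y : E3) (w : E4) :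
    ‖fderiv ℝ (A.Fw lam) (E4.ofTimeSpace t y) w‖ ≤
      Real.exp (-2 * (lam * c₀) * ‖y - D.c t‖ ^ 2) *
        (lam ^ 2 * (3 * M * ‖w‖) + lam ^ 3 * (24 * ‖w‖ * Dd) * ‖y - D.c t‖) := by
  set x := E4.ofTimeSpace t y with hx
  have hlam0 : 0 ≤ lam := by linarith
  have hM0 : 0 ≤ M := (norm_nonneg _).trans (hM 0 x)
  by_cases hxs : x ∈ tsupport A.amp
  · have hgw : D.gw lam x ≤ Real.exp (-2 * (lam * c₀) * ‖y - D.c t‖ ^ 2) := by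
      have him := hIm x (by simpa [hx] using ht)
      simp only [hx, E4.spatial_ofTimeSpace, E4.ofTimeSpace_apply_zero] at him
      unfold BeamData.gw
      apply Real.exp_le_exp.2
      nlinarith
    rw [A.fderiv_Fw_apply lam hxs w, norm_mul, Complex.norm_real, Real.norm_eq_abs,
      abs_of_pos (D.gw_pos lam x)]
    have e1 := A.norm_fderiv_densO_le hM hlam x w
    have e2 := A.norm_densO_mul_abs_im_le hDd hlam ht y w
    have hin : ‖fderiv ℝ (A.densO lam) x w - 2 * lam * ((fderiv ℝ D.φ x w).im : ℂ) * A.densO lam x‖ ≤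
        3 * lam ^ 2 * M * ‖w‖ + 2 * lam * (12 * lam ^ 2 * ‖w‖ * Dd * ‖y - D.c t‖) := by
      refine (norm_sub_le _ _).trans (add_le_add e1 ?_)
      rw [norm_mul, norm_mul, norm_mul, Complex.norm_real, Real.norm_eq_abs, Complex.norm_two,
        Complex.norm_real, Real.norm_eq_abs, abs_of_nonneg hlam0]
      calc 2 * lam * |(fderiv ℝ D.φ x w).im| * ‖A.densO lam x‖
          = 2 * lam * (‖A.densO lam x‖ * |(fderiv ℝ D.φ x w).im|) := by ring
        _ ≤ 2 * lam * (12 * lam ^ 2 * ‖w‖ * Dd * ‖y - D.c t‖) :=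
          mul_le_mul_of_nonneg_left e2 (by positivity)
    calc D.gw lam x * ‖fderiv ℝ (A.densO lam) x w - 2 * lam * ((fderiv ℝ D.φ x w).im : ℂ) * A.densO lam x‖
        ≤ Real.exp (-2 * (lam * c₀) * ‖y - D.c t‖ ^ 2) *
            (3 * lam ^ 2 * M * ‖w‖ + 2 * lam * (12 * lam ^ 2 * ‖w‖ * Dd * ‖y - D.c t‖)) :=
          mul_le_mul hgw hin (norm_nonneg _) (Real.exp_nonneg _)
      _ = _ := by ring
  · have hzero : A.Fw lam =ᶠ[𝓝 x] fun _ ↦ 0 := by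
      filter_upwards [(isClosed_tsupport A.amp).isOpen_compl.mem_nhds hxs] with z hz using A.Fw_eq_zero lam hz
    rw [hzero.fderiv_eq, fderiv_fun_const]
    simp only [Pi.zero_apply, zero_apply, norm_zero]
    have hDd0 : 0 ≤ Dd * ‖y - D.c t‖ := by
      have := hDd 0 t ht y 0
      exact (by positivity : (0 : ℝ) ≤ ‖A.dd 0 (E4.ofTimeSpace t y)‖ * |(dC D.φ (E4.ofTimeSpace t y) 0).im|).trans this
    have : 0 ≤ lam ^ 3 * (24 * ‖w‖ * Dd) * ‖y - D.c t‖ := by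
      have : lam ^ 3 * (24 * ‖w‖ * Dd) * ‖y - D.c t‖ = lam ^ 3 * (24 * ‖w‖) * (Dd * ‖y - D.c t‖) := by ring
      rw [this]; positivity
    positivity

/-- **Pointwise bound for the weighted amplitude along the beam**:
`‖F_λ(t,y)‖ ≤ 3λ² N e^{-2λc₀‖y−c(t)‖²}` over the hull. [cite: Sbierski2015, §4 (third remark)] -/
theorem norm_Fw_le {N c₀ : ℝ} (hN : ∀ k x, ‖A.dd k x‖ ≤ N)
    (hIm : ∀ x : E4, x 0 ∈ A.timeHull → c₀ * ‖E4.spatial x - D.c (x 0)‖ ^ 2 ≤ (D.φ x).im)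
    {lam : ℝ} (hlam : 1 ≤ lam) {t : ℝ} (ht : t ∈ A.timeHull) (y : E3) :
    ‖A.Fw lam (E4.ofTimeSpace t y)‖ ≤ Real.exp (-2 * (lam * c₀) * ‖y - D.c t‖ ^ 2) * (3 * lam ^ 2 * N) := by
  set x := E4.ofTimeSpace t y with hx
  have hgw : D.gw lam x ≤ Real.exp (-2 * (lam * c₀) * ‖y - D.c t‖ ^ 2) := by
    have him := hIm x (by simpa [hx] using ht)
    simp only [hx, E4.spatial_ofTimeSpace, E4.ofTimeSpace_apply_zero] at him
    unfold BeamData.gw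
    apply Real.exp_le_exp.2
    have : 0 ≤ lam := by linarith
    nlinarith
  rw [Fw, norm_mul, Complex.norm_real, Real.norm_eq_abs, abs_of_pos (D.gw_pos lam x)]
  exact mul_le_mul hgw (A.norm_densO_le hN hlam x) (norm_nonneg _) (Real.exp_nonneg _)

/-- **`|∂_v∂_vψ_τ(y)| ≤ 2 H ‖(0,v)‖²`** at beam points, `H` bounding `‖d²φ‖` on `supp a`.
[folklore] -/
theorem abs_fderiv_fderiv_ψs_le {H : ℝ} (hH : ∀ x ∈ tsupport A.amp, ‖fderiv ℝ (fderiv ℝ D.φ) x‖ ≤ H)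
    {τ : ℝ} (hτ : τ ∈ J) {y : E3} (hy : E4.ofTimeSpace τ y ∈ tsupport A.amp) (v : E3) :
    |fderiv ℝ (fun z ↦ fderiv ℝ (D.ψs τ) z v) y v| ≤ 2 * H * ‖E4.spaceEmbed v‖ ^ 2 := by
  rw [D.fderiv_fderiv_ψs hτ y v, abs_mul, abs_of_pos (by norm_num : (0 : ℝ) < 2)]
  have hH0 : 0 ≤ H := le_trans (norm_nonneg (fderiv ℝ (fderiv ℝ D.φ) (E4.ofTimeSpace τ y))) (hH _ hy)
  rw [mul_assoc]
  refine mul_le_mul_of_nonneg_left ((Complex.abs_re_le_norm _).trans ?_) (by norm_num)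
  calc ‖(fderiv ℝ (fderiv ℝ D.φ) (E4.ofTimeSpace τ y) (E4.spaceEmbed v)) (E4.spaceEmbed v)‖
      ≤ ‖fderiv ℝ (fderiv ℝ D.φ) (E4.ofTimeSpace τ y) (E4.spaceEmbed v)‖ * ‖E4.spaceEmbed v‖ :=
        ContinuousLinearMap.le_opNorm _ _
    _ ≤ ‖fderiv ℝ (fderiv ℝ D.φ) (E4.ofTimeSpace τ y)‖ * ‖E4.spaceEmbed v‖ * ‖E4.spaceEmbed v‖ :=
        mul_le_mul_of_nonneg_right (ContinuousLinearMap.le_opNorm _ _) (norm_nonneg _)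
    _ ≤ H * ‖E4.spaceEmbed v‖ * ‖E4.spaceEmbed v‖ := by gcongr; exact hH _ hy
    _ = H * ‖E4.spaceEmbed v‖ ^ 2 := by ring

/-- `‖d²φ‖ ≤ H` on `supp a`. [folklore] -/
theorem exists_ddφ_bound : ∃ H : ℝ, 0 ≤ H ∧ ∀ x ∈ tsupport A.amp, ‖fderiv ℝ (fderiv ℝ D.φ) x‖ ≤ H :=
  A.exists_bound_on_tsupport A.tsupp_slab
    (((D.contDiffOn_φ.fderiv_of_isOpen (isOpen_slab D.hJ) (m := ∞) (by simp)).fderiv_of_isOpen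
      (isOpen_slab D.hJ) (m := ∞) (by simp)).continuousOn)

end BeamAmp

/-! ### The cross term is bounded -/

namespace BeamAmp

variable {G : E4 → Fin 4 → Fin 4 → ℝ} {V : Set E4} {J : Set ℝ} {D : BeamData G V J} {T : ℝ}
  (A : BeamAmp D T)

/-- **The oscillatory cross term of the energy of the real beam is `O(1)`** ("for real-valued
beams the computations become a bit longer": the leaf integrals `∫ Re(e^{2iλφ} densC(B,B))` are
bounded uniformly in `λ ≥ 1` and `0 ≤ τ ≤ T`), given directions `Z(τ)`, bounded on `[0, T]`,
with `Re ∂_{Z(τ)} φ(τ, ·) ≥ ½` on the beam (available on a thin beam since `dφ|_γ = γ̇♭ ≠ 0`):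
one integration by parts in the direction `Z(τ)` against `e^{2iλ Re φ}`
(`norm_integral_cexp_phase_mul_le_of_le`), the `λ` from differentiating the Gaussian weight
`e^{-2λ Im φ}` carrying the factor `Im dφ = O(‖y − c‖)`. [cite: Sbierski2015, §4 (third remark after the theorem); HormanderALPDO1, Thm. 7.7.1] -/
theorem exists_cross_bound (Z : ℝ → E3) {Zb : ℝ} (hZb : ∀ τ ∈ Icc (0 : ℝ) T, ‖Z τ‖ ≤ Zb)
    (hZ : ∀ τ ∈ Icc (0 : ℝ) T, ∀ y : E3, E4.ofTimeSpace τ y ∈ tsupport A.amp →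
      2⁻¹ ≤ (fderiv ℝ (fun y ↦ D.φ (E4.ofTimeSpace τ y)) y (Z τ)).re) :
    ∃ Kc : ℝ, 0 ≤ Kc ∧ ∀ lam : ℝ, 1 ≤ lam → ∀ τ ∈ Icc (0 : ℝ) T,
      |∫ y, A.wdensO lam (E4.ofTimeSpace τ y)| ≤ Kc := by
  obtain ⟨N, M, Dd, hN0, hM0, hDd0, hN, hM, hDd⟩ := A.exists_dd_bounds
  obtain ⟨H, hH0, hH⟩ := A.exists_ddφ_bound
  obtain ⟨c₀, hc₀, hIm⟩ := A.exists_pos_le_im_φ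
  have h0T : (0 : ℝ) ∈ Icc (0 : ℝ) T := ⟨le_rfl, A.hT0⟩
  have hZb0 : 0 ≤ Zb := (norm_nonneg _).trans (hZb 0 h0T)
  set L : ℝ := ‖E4.spaceEmbed‖ * Zb with hL
  have hL0 : 0 ≤ L := by positivity
  set I0 : ℝ := ∫ z : E3, ‖z‖ ^ 0 * Real.exp (-2 * ‖z‖ ^ 2) with hI0
  set I1 : ℝ := ∫ z : E3, ‖z‖ ^ 1 * Real.exp (-2 * ‖z‖ ^ 2) with hI1
  have hI0n : 0 ≤ I0 := integral_norm_pow_mul_exp_neg_two_mul_sq_nonneg 0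
  have hI1n : 0 ≤ I1 := integral_norm_pow_mul_exp_neg_two_mul_sq_nonneg 1
  have hsc : 0 < (√c₀)⁻¹ := inv_pos.2 (Real.sqrt_pos.2 hc₀)
  set α₀ : ℝ := 3 * M * L with hα₀
  set β₀ : ℝ := 24 * L * Dd with hβ₀
  set γ₀ : ℝ := 2 * H * L ^ 2 * (3 * N) with hγ₀
  refine ⟨α₀ * ((√c₀)⁻¹ ^ 3 * I0) + β₀ * ((√c₀)⁻¹ ^ 4 * I1) + γ₀ * ((√c₀)⁻¹ ^ 3 * I0), by positivity,
    fun lam hlam τ hτ ↦ ?_⟩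
  have hlam0 : 0 < lam := one_pos.trans_le hlam
  have hτJ : τ ∈ J := A.Icc_subset hτ
  have hτH : τ ∈ A.timeHull := A.Icc_subset_timeHull hτ
  -- the data of the non-stationary phase lemma
  set ψ : E3 → ℝ := D.ψs τ with hψdef
  set b : E3 → ℂ := fun y ↦ A.Fw lam (E4.ofTimeSpace τ y) with hbdef
  set v : E3 := Z τ with hv
  have hw : ‖E4.spaceEmbed v‖ ≤ L :=
    (ContinuousLinearMap.le_opNorm _ _).trans (mul_le_mul_of_nonneg_left (hZb τ hτ) (norm_nonneg _))
  have h2le : ((2 : ℕ) : ℕ∞ω) ≤ ∞ := by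
    rw [show ((2 : ℕ) : ℕ∞ω) = (((2 : ℕ) : ℕ∞) : ℕ∞ω) from (WithTop.coe_natCast 2).symm]
    exact WithTop.coe_le_coe.2 le_top
  have hψ2 : ContDiff ℝ 2 ψ := (D.contDiff_ψs hτJ).of_le h2le
  have hb1 : ContDiff ℝ 1 b :=
    ((A.contDiff_Fw lam).comp (E4.contDiff_ofTimeSpace τ)).of_le (by exact_mod_cast le_top)
  have hbs : HasCompactSupport b := hasCompactSupport_slice (A.hasCompactSupport_Fw lam) τ
  -- the support of `b` lies over the beam
  have hbsupp : ∀ y ∈ tsupport b, E4.ofTimeSpace τ y ∈ tsupport A.amp := by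
    intro y hy
    have hcl : IsClosed {y : E3 | E4.ofTimeSpace τ y ∈ tsupport A.amp} :=
      (isClosed_tsupport _).preimage (E4.contDiff_ofTimeSpace τ (n := 0)).continuous
    have hsub : Function.support b ⊆ {y : E3 | E4.ofTimeSpace τ y ∈ tsupport A.amp} := by
      intro y hy
      by_contra h
      exact hy (A.Fw_eq_zero lam h)
    exact closure_minimal hsub hcl hy
  -- `|∂_vψ| ≥ 1` on `tsupport b`
  have hvψ : ∀ y ∈ tsupport b, (1 : ℝ) ≤ |fderiv ℝ ψ y v| := by
    intro y hy
    have h := hZ τ hτ y (hbsupp y hy)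
    rw [D.fderiv_φ_slice hτJ] at h
    rw [hψdef, D.fderiv_ψs hτJ y v]
    have : (1 : ℝ) ≤ 2 * (fderiv ℝ D.φ (E4.ofTimeSpace τ y) (E4.spaceEmbed v)).re := by linarith
    exact this.trans (le_abs_self _)
  have hmain := Literature.Analysis.Asymptotics.norm_integral_cexp_phase_mul_le_of_le (μ := volume)
    hψ2 hb1 hbs one_pos hvψ hlam0.ne'
  -- the first leaf integral
  have hIA : ∫ y, ‖fderiv ℝ b y v‖ ≤
      lam ^ 2 * α₀ * ((√(lam * c₀))⁻¹ ^ (0 + 3) * I0) +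
        lam ^ 3 * β₀ * ((√(lam * c₀))⁻¹ ^ (1 + 3) * I1) := by
    have hpt : ∀ y, |‖fderiv ℝ b y v‖| ≤ Real.exp (-2 * (lam * c₀) * ‖y - D.c τ‖ ^ 2) *
        (lam ^ 2 * α₀ + lam ^ 3 * β₀ * ‖y - D.c τ‖ + 0 * ‖y - D.c τ‖ ^ 2 + 0 * ‖y - D.c τ‖ ^ 3) := by
      intro y
      rw [abs_of_nonneg (norm_nonneg _)]
      have hchain : fderiv ℝ b y v = fderiv ℝ (A.Fw lam) (E4.ofTimeSpace τ y) (E4.spaceEmbed v) := by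
        have h : HasFDerivAt b ((fderiv ℝ (A.Fw lam) (E4.ofTimeSpace τ y)).comp E4.spaceEmbed) y :=
          (((A.contDiff_Fw lam).differentiable (by simp)) _).hasFDerivAt.comp y (hasFDerivAt_slice τ y)
        rw [h.fderiv]; rfl
      rw [hchain]
      refine (A.norm_fderiv_Fw_le hM hDd hIm hlam hτH y (E4.spaceEmbed v)).trans
        (mul_le_mul_of_nonneg_left ?_ (Real.exp_nonneg _))
      have h1 : lam ^ 2 * (3 * M * ‖E4.spaceEmbed v‖) ≤ lam ^ 2 * α₀ := by
        rw [hα₀]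
        exact mul_le_mul_of_nonneg_left (mul_le_mul_of_nonneg_left hw (by positivity)) (by positivity)
      have h2 : lam ^ 3 * (24 * ‖E4.spaceEmbed v‖ * Dd) * ‖y - D.c τ‖ ≤ lam ^ 3 * β₀ * ‖y - D.c τ‖ := by
        rw [hβ₀]
        refine mul_le_mul_of_nonneg_right (mul_le_mul_of_nonneg_left ?_ (by positivity)) (norm_nonneg _)
        nlinarith [hw, hDd0, norm_nonneg (E4.spaceEmbed v)]
      linarith
    have h := abs_integral_le_of_abs_le_poly3 (D.c τ) (mul_pos hlam0 hc₀) hpt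
    rw [abs_of_nonneg (integral_nonneg fun y ↦ norm_nonneg _)] at h
    refine h.trans (le_of_eq ?_)
    rw [← hI0, ← hI1]; ring
  -- the second leaf integral
  have hIB : ∫ y, |fderiv ℝ (fun z ↦ fderiv ℝ ψ z v) y v| * ‖b y‖ ≤
      lam ^ 2 * γ₀ * ((√(lam * c₀))⁻¹ ^ (0 + 3) * I0) := by
    have hpt : ∀ y, |(|fderiv ℝ (fun z ↦ fderiv ℝ ψ z v) y v| * ‖b y‖)| ≤
        Real.exp (-2 * (lam * c₀) * ‖y - D.c τ‖ ^ 2) *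
          (lam ^ 2 * γ₀ + 0 * ‖y - D.c τ‖ + 0 * ‖y - D.c τ‖ ^ 2 + 0 * ‖y - D.c τ‖ ^ 3) := by
      intro y
      rw [abs_of_nonneg (by positivity)]
      by_cases hx : E4.ofTimeSpace τ y ∈ tsupport A.amp
      · have e1 := A.abs_fderiv_fderiv_ψs_le hH hτJ hx v
        have e2 := A.norm_Fw_le hN hIm hlam hτH y
        have hL2 : ‖E4.spaceEmbed v‖ ^ 2 ≤ L ^ 2 := pow_le_pow_left₀ (norm_nonneg _) hw 2
        calc |fderiv ℝ (fun z ↦ fderiv ℝ ψ z v) y v| * ‖b y‖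
            ≤ (2 * H * ‖E4.spaceEmbed v‖ ^ 2) *
                (Real.exp (-2 * (lam * c₀) * ‖y - D.c τ‖ ^ 2) * (3 * lam ^ 2 * N)) :=
              mul_le_mul e1 e2 (norm_nonneg _) (by positivity)
          _ ≤ (2 * H * L ^ 2) * (Real.exp (-2 * (lam * c₀) * ‖y - D.c τ‖ ^ 2) * (3 * lam ^ 2 * N)) := by
              gcongr
          _ = _ := by rw [hγ₀]; ring
      · have hb0 : b y = 0 := A.Fw_eq_zero lam hx
        rw [hb0, norm_zero, mul_zero]
        positivity
    have h := abs_integral_le_of_abs_le_poly3 (D.c τ) (mul_pos hlam0 hc₀) hpt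
    rw [abs_of_nonneg (integral_nonneg fun y ↦ by positivity)] at h
    refine h.trans (le_of_eq ?_)
    rw [← hI0]; ring
  -- powers of `λ`
  have hsl : √lam * √lam = lam := Real.mul_self_sqrt hlam0.le
  have hsl1 : 1 ≤ √lam := by rw [← Real.sqrt_one]; exact Real.sqrt_le_sqrt hlam
  have hs1 : (√lam)⁻¹ ≤ 1 := inv_le_one_of_one_le₀ hsl1
  have hs0 : 0 ≤ (√lam)⁻¹ := inv_nonneg.2 (zero_le_one.trans hsl1)
  have hsne : √lam ≠ 0 := (one_pos.trans_le hsl1).ne'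
  have hs2 : (√lam)⁻¹ * (√lam)⁻¹ = lam⁻¹ := by rw [← mul_inv, hsl]
  have hll : lam * lam⁻¹ = 1 := mul_inv_cancel₀ hlam0.ne'
  have e3 : lam⁻¹ * (lam ^ 2 * (√lam)⁻¹ ^ (0 + 3)) = (√lam)⁻¹ := by
    calc lam⁻¹ * (lam ^ 2 * (√lam)⁻¹ ^ (0 + 3))
        = (lam * lam⁻¹) * (lam * ((√lam)⁻¹ * (√lam)⁻¹)) * (√lam)⁻¹ := by ring
      _ = (√lam)⁻¹ := by rw [hs2, hll]; ring
  have e4 : lam⁻¹ * (lam ^ 3 * (√lam)⁻¹ ^ (1 + 3)) = 1 := by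
    calc lam⁻¹ * (lam ^ 3 * (√lam)⁻¹ ^ (1 + 3))
        = (lam * lam⁻¹) * (lam * ((√lam)⁻¹ * (√lam)⁻¹)) * (lam * ((√lam)⁻¹ * (√lam)⁻¹)) := by ring
      _ = 1 := by rw [hs2, hll]; ring
  -- combine
  rw [A.integral_wdensO_eq lam τ]
  have hcongr : (∫ y, cexp (2 * I * lam * D.φ (E4.ofTimeSpace τ y)) * A.densO lam (E4.ofTimeSpace τ y)) =
      ∫ y, cexp (I * lam * ψ y) * b y :=
    integral_congr_ae (Eventually.of_forall fun y ↦ A.cexp_mul_densO_eq lam τ y)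
  rw [hcongr]
  refine (Complex.abs_re_le_norm _).trans (hmain.trans ?_)
  rw [abs_of_pos hlam0, inv_one, one_pow, one_mul, one_mul]
  rw [Real.sqrt_mul hlam0.le, mul_inv, mul_pow, mul_pow] at hIA
  rw [Real.sqrt_mul hlam0.le, mul_inv, mul_pow] at hIB
  calc lam⁻¹ * ((∫ y, ‖fderiv ℝ b y v‖) + ∫ y, |fderiv ℝ (fun z ↦ fderiv ℝ ψ z v) y v| * ‖b y‖)
      ≤ lam⁻¹ * ((lam ^ 2 * α₀ * ((√lam)⁻¹ ^ (0 + 3) * (√c₀)⁻¹ ^ (0 + 3) * I0) +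
          lam ^ 3 * β₀ * ((√lam)⁻¹ ^ (1 + 3) * (√c₀)⁻¹ ^ (1 + 3) * I1)) +
          lam ^ 2 * γ₀ * ((√lam)⁻¹ ^ (0 + 3) * (√c₀)⁻¹ ^ (0 + 3) * I0)) :=
        mul_le_mul_of_nonneg_left (add_le_add hIA hIB) (by positivity)
    _ = (lam⁻¹ * (lam ^ 2 * (√lam)⁻¹ ^ (0 + 3))) * (α₀ * ((√c₀)⁻¹ ^ 3 * I0)) +
        (lam⁻¹ * (lam ^ 3 * (√lam)⁻¹ ^ (1 + 3))) * (β₀ * ((√c₀)⁻¹ ^ 4 * I1)) +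
        (lam⁻¹ * (lam ^ 2 * (√lam)⁻¹ ^ (0 + 3))) * (γ₀ * ((√c₀)⁻¹ ^ 3 * I0)) := by ring
    _ = (√lam)⁻¹ * (α₀ * ((√c₀)⁻¹ ^ 3 * I0)) + 1 * (β₀ * ((√c₀)⁻¹ ^ 4 * I1)) +
        (√lam)⁻¹ * (γ₀ * ((√c₀)⁻¹ ^ 3 * I0)) := by rw [e3, e4]
    _ ≤ 1 * (α₀ * ((√c₀)⁻¹ ^ 3 * I0)) + 1 * (β₀ * ((√c₀)⁻¹ ^ 4 * I1)) +
        1 * (γ₀ * ((√c₀)⁻¹ ^ 3 * I0)) := by gcongr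
    _ = _ := by ring

/-- **Characterisation of the energy of the real Gaussian beam** (`energy_characterisation` with
the cross-term hypothesis discharged by `exists_cross_bound`): given the thinness data `δ` and the
directions `Z`, there are `C_b ≥ 0`, `g₀ > 0`, `K' ≥ 0` with, for all `λ ≥ 1`,
`E(0) ≥ g₀ √λ − K'` and `|E(τ) − (κ(τ)/κ(0)) E(0)| ≤ (2 (1 + κ_max/κ(0)) / κ(0)) δ E(0) + C_b`
for `0 ≤ τ ≤ T`. [cite: Sbierski2015, §4 (the theorem, its proof and the third remark)] -/
theorem energy_characterisation' {δ κmax Zb : ℝ} (hδ0 : 0 ≤ δ)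
    (hδκ : ∀ τ ∈ Icc (0 : ℝ) T, 2 * δ ≤ D.κ τ) (hκmax : ∀ τ ∈ Icc (0 : ℝ) T, D.κ τ ≤ κmax)
    (hδ : ∀ τ ∈ Icc (0 : ℝ) T, ∀ y : E3, E4.ofTimeSpace τ y ∈ tsupport A.amp →
      |D.tCo (E4.ofTimeSpace τ y) - D.κ τ| ≤ δ)
    (Z : ℝ → E3) (hZb : ∀ τ ∈ Icc (0 : ℝ) T, ‖Z τ‖ ≤ Zb)
    (hZ : ∀ τ ∈ Icc (0 : ℝ) T, ∀ y : E3, E4.ofTimeSpace τ y ∈ tsupport A.amp →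
      2⁻¹ ≤ (fderiv ℝ (fun y ↦ D.φ (E4.ofTimeSpace τ y)) y (Z τ)).re) :
    ∃ Cb g₀ K' : ℝ, 0 ≤ Cb ∧ 0 < g₀ ∧ 0 ≤ K' ∧ ∀ lam : ℝ, 1 ≤ lam →
      g₀ * √lam - K' ≤ A.energy lam 0 ∧
      ∀ τ ∈ Icc (0 : ℝ) T, |A.energy lam τ - D.κ τ / D.κ 0 * A.energy lam 0| ≤
        (2 * (1 + κmax / D.κ 0) / D.κ 0) * δ * A.energy lam 0 + Cb := by
  obtain ⟨Kc, _, hcross⟩ := A.exists_cross_bound Z hZb hZ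
  exact A.energy_characterisation hδ0 hδκ hκmax hδ hcross

end BeamAmp

end GaussianBeam

end Literature.Geometry.Lorentzian
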